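import Literature.NumberTheory.EllipticCurves.TakahashiDegreeFormula
import HarnessLib

/-!
# Stub ideation k1, GEN 9 (FAMILY 1 — recognise & import) for `stub_takahashi`
# (crux `DefiniteXi.DefiniteRTControlPrime`, stmt-ABC-11338) — companion of
# `STUB-IDEAS-stub_takahashi-1.md` (gen 9), §0 (b) / §5 R0 only.

Gen 9 adds NO new mathematical leaf (the leaves D1 / H1 / H0 and the glue A1–A11, S1–S4 are the
gen-6/7 companions `StubIdeas1G6TakahashiSketch.lean`, `StubIdeas1G7TakahashiSketch.lean`, unchanged).
It records the ONE registry artefact nobody prepared: the body of the registered stub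
`stub_takahashi : takahashi2001_thm_2_3_of_coprime` written out VERBATIM and FULLY QUALIFIED, in the
shape the route's other two print stubs already have as items (`MazurKenkuBound` = stmt-ABC-15125 ≡
`PastenShimura2024_minimalDegree_le_163_mul`, `IsogenyValuationTransport` = stmt-ABC-18928 ≡
`PastenShimura2024_lemma_6_8`, both `Iff.rfl` their facts), so that a tenure / route-choice planner
can file it as an `aside` item of `route-ABC-DefiniteXi` with one `workitem add --signature` and the
stub prover's verdict becomes a well-formed `blocked-on: stmt-ABC-<id>`.
-/

set_option linter.dupNamespace false

noncomputable section

namespace Summit.ABC.ABC.Cruxes.DefiniteRTControlPrime.StubIdeas1G9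

/-- **R0 — proposed `aside` item `TakahashiCoprimeDegreeFormula` of route DefiniteXi** (verbatim the
body of the named fact `Literature.NumberTheory.EllipticCurves.takahashi2001_thm_2_3_of_coprime`,
Takahashi 2001 Thm 2.3 at `r ∥ N`; every constant fully qualified as the gate renders route items). -/
def TakahashiCoprimeDegreeFormula : Prop :=
  ∀ (W : WeierstrassCurve ℚ) [W.IsElliptic] (M r : ℕ) [NeZero (M * r)],
    r.Prime → M.Coprime r → W.conductorNorm ℤ = M * r →
    ∀ P : Literature.NumberTheory.EllipticCurves.ModularForms.ModularParametrizationData W (M * r),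
      (∀ (W' : WeierstrassCurve ℚ) [W'.IsElliptic], W'.conductorNorm ℤ = M * r →
          ∀ P' : Literature.NumberTheory.EllipticCurves.ModularForms.ModularParametrizationData W' (M * r),
          P'.f = P.f → P.modularDegree ≤ P'.modularDegree) →
      ∀ S : Literature.NumberTheory.Automorphic.Brandt.XiSetup M r,
        ∃ i j : ℕ, 0 < i ∧ i * j = (W.minimalDiscriminantNorm ℤ).factorization r ∧
          i ∣ S.xi (fun n => W.LFunction n) ∧
          P.modularDegree * i = S.xi (fun n => W.LFunction n) * j

/-- The proposed item is DEFINITIONALLY the named fact (so `stub_takahashi := h` closes the stub the day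
the item closes, and the item closes by `exact takahashi2001_thm_2_3_of_coprime_holds` the day the fact
is discharged). -/
theorem item_iff_fact :
    TakahashiCoprimeDegreeFormula ↔
      Literature.NumberTheory.EllipticCurves.takahashi2001_thm_2_3_of_coprime :=
  Iff.rfl

/-- `stub_takahashi` from the item, by `exact`. -/
theorem stub_of_item (h : TakahashiCoprimeDegreeFormula) :
    Literature.NumberTheory.EllipticCurves.takahashi2001_thm_2_3_of_coprime :=
  h

/-- Conversely the item from the fact (so the item is not stronger than what is in print). -/
theorem item_of_fact (h : Literature.NumberTheory.EllipticCurves.takahashi2001_thm_2_3_of_coprime) :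
    TakahashiCoprimeDegreeFormula :=
  h

/-- Sanity: the item implies the tree's square-free fact (Takahashi's printed standing hypothesis). -/
theorem squarefreeFact_of_item (h : TakahashiCoprimeDegreeFormula) :
    Literature.NumberTheory.EllipticCurves.takahashi2001_thm_2_3 :=
  Literature.NumberTheory.EllipticCurves.takahashi2001_thm_2_3_of_of_coprime h

end Summit.ABC.ABC.Cruxes.DefiniteRTControlPrime.StubIdeas1G9

end
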